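import Literature.NumberTheory.EllipticCurves.TwoAdicImageSurjectivityModFourProofs
import Literature.NumberTheory.EllipticCurves.TwoAdicImageSurjectivityModEightProofs
import Literature.NumberTheory.EllipticCurves.IsogenyHasCMIffJMemProofs
import HarnessLib

/-!
# The non-surjective `2`-adic images of elliptic curves over `ℚ`, as five families — and
# `ρ̄_{E,4}` is NEVER onto for a CM curve (proofs only)

Topic `NumberTheory/EllipticCurves`; theorem-only `Proofs`-style file (no definition, no named fact,
no instance, no `sorry`; D-0014/D-0026).  Everything here is a corollary of theorems already PROVED in
the tree: Dokchitser–Dokchitser 2012, Theorem (1)–(3) (`hasSurjectiveModNGaloisRep_two_iff`,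
`DokchitserDokchitser2012.hasSurjectiveModNGaloisRep_four_iff`,
`DokchitserDokchitser2012.hasSurjectiveModNGaloisRep_eight_iff`), the mod-`8` ⟹ `2`-adic lift
(`hasSurjectiveModNGaloisRep_two_pow_of_eight_holds`), and the thirteen CM `j`-invariants
(`WeierstrassCurve.hasCM_iff_j_mem_holds`).

* §1 `exists_two_torsion_of_j_mul_eq` — the `X₀(2)` parametrisation of a rational `2`-torsion point:
  over a field with `6 ≠ 0`, if `j(E)·((κ + 3)²(κ - 6)) = 1728κ³` for some `κ ≠ 0` (written out:
  `j·(κ³ - 27κ - 54) = 1728κ³`), then `E(K)` has a point of exact order `2`, namely the point of the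
  line `2y + a₁x + a₃ = 0` with `36x + 3b₂ = κ·c₆/c₄` (on that line the Weierstrass equation is the
  `2`-division cubic `4x³ + b₂x² + 2b₄x + b₆`, and `11664` times it is `X³ - 27c₄X - 54c₆` at
  `X = 36x + 3b₂`).
* §2 **`WeierstrassCurve.not_hasSurjectiveModNGaloisRep_four_of_hasCM`** — for EVERY elliptic curve
  `E/ℚ` with (geometric) complex multiplication, `ρ̄_{E,4} : Γ_ℚ → Aut(E[4])` is not onto; hence
  `ρ̄_{E,2^m}` is not onto for any `m ≥ 2`, and a curve with surjective `2`-adic image has no CM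
  (`not_hasCM_of_forall_hasSurjectiveModNGaloisRep_two_pow`).  This is the prime `2` left out by the
  tree's `ZywinaCMImageProofs` ("every ODD `ℓ`"; at level `2` itself a CM curve CAN be onto, e.g.
  `y² = x³ + 2`).  Proof: `j(E)` is one of the thirteen CM values; eight of them
  (`0, 1728, -32768, -884736, -12288000, -884736000, -147197952000, -262537412640768000`) are
  `-4t³(t + 8)` at `t = -8, -6, 8, -24, 40, 120, -440, -16008`, which Dokchitser–Dokchitser (2)
  excludes; the other five (`-3375, 8000, 54000, 287496, 16581375`) satisfy §1 with
  `κ = 5, -30/7, -30/11, -22/7, -170/57`, so `E(ℚ)[2] ≠ 0`, which Dokchitser–Dokchitser (1) excludes.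
  In print: Á. Lozano-Robledo, *Galois representations attached to elliptic curves with complex
  multiplication*, Algebra Number Theory 16 (2022) 777–837, Thm. 1.1 (for `N ≥ 3` the image of
  `ρ_{E,N}` lies in the normaliser `𝒩_{δ,φ}(N)` of a Cartan subgroup — a proper subgroup of
  `GL₂(ℤ/4ℤ)` at `N = 4`).
* §3 `not_forall_hasSurjectiveModNGaloisRep_two_pow_iff` — the complement of the "surjective
  `2`-adic image" habitat TYPED EXACTLY: `ρ_{E,2^∞}` is not onto iff `E(ℚ)[2] ≠ 0`, or `Δ ∈ ℚ^{×2}`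
  (`C₃` image modulo `2`), or `-Δ ∈ ℚ^{×2}`, or `j(E) = -4t³(t + 8)` for some `t ∈ ℚ`, or
  `±2Δ ∈ ℚ^{×2}`; together with `forall_hasSurjectiveModNGaloisRep_two_pow_iff_eight` /
  `…_iff_criteria` (the habitat is decided modulo `8`).

Written for the BSD cell `bsd-2adic` (routes `TwoAdicConverse` / `KolyvaginRankRigidityAtTwo`, whose
cruxes carry the binders `¬ W.HasCM` and `∀ m, W.HasSurjectiveModNGaloisRep (2 ^ m)`: by §2 the
first is implied by the second, and by §3 the complement of the second is a union of five explicit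
families).  No elliptic-curve fact is asserted; nothing about BSD is claimed.

## References

* [DokchitserDokchitserMathZ2012] T. Dokchitser, V. Dokchitser, *Surjectivity of mod `2ⁿ`
  representations of elliptic curves*, Math. Z. 272 (2012) 961–964, Theorem (1)–(3) and Lemma.
* [LozanoRobledo2022] Á. Lozano-Robledo, *Galois representations attached to elliptic curves with
  complex multiplication*, Algebra Number Theory 16 (2022), no. 4, 777–837 (arXiv:1809.02584),
  Thm. 1.1. [corpus:paper:arxiv-1809.02584 p0003 L11–L32]
* [SilvermanAEC2009] J. H. Silverman, *The Arithmetic of Elliptic Curves*, 2nd ed., GTM 106 (2009),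
  III.1 (`b`-, `c`-invariants, `1728Δ = c₄³ - c₆²`, `j = c₄³/Δ`), Prop. III.2.3 (points of order
  `2`), App. C §11 (CM `j`-invariants).
* [RouseZureickbrown2015] J. Rouse, D. Zureick-Brown, *Elliptic curves over `ℚ` and `2`-adic images
  of Galois*, Res. Number Theory 1 (2015), §1 and §3.
-/

set_option autoImplicit false

open WeierstrassCurve

namespace Literature.NumberTheory.EllipticCurves

/-! ### §1. A rational point of order `2` from the `X₀(2)` parametrisation of `j` -/

section XZeroTwo

universe u

variable {K : Type u} [Field K] (W : WeierstrassCurve K)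

/-- On the line `2y + a₁x + a₃ = 0` the Weierstrass equation of `W` reads
`4x³ + b₂x² + 2b₄x + b₆ = 0` (the `2`-division cubic), provided `2 ≠ 0` in `K`.
[cite: SilvermanAEC2009, III.1 and Prop. III.2.3 (points of order 2)] -/
theorem equation_line_iff_twoDivision (h2 : (2 : K) ≠ 0) (x : K) :
    W.toAffine.Equation x (-(W.a₁ * x + W.a₃) / 2) ↔
      4 * x ^ 3 + W.b₂ * x ^ 2 + 2 * W.b₄ * x + W.b₆ = 0 := by
  have h4 : (-4 : K) ≠ 0 := by
    rw [show (-4 : K) = -(2 * 2) by norm_num]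
    exact neg_ne_zero.mpr (mul_ne_zero h2 h2)
  rw [WeierstrassCurve.Affine.equation_iff']
  have key : ((-(W.a₁ * x + W.a₃) / 2) ^ 2 + W.a₁ * x * (-(W.a₁ * x + W.a₃) / 2) +
      W.a₃ * (-(W.a₁ * x + W.a₃) / 2) - (x ^ 3 + W.a₂ * x ^ 2 + W.a₄ * x + W.a₆)) * (-4) =
        4 * x ^ 3 + W.b₂ * x ^ 2 + 2 * W.b₄ * x + W.b₆ := by
    simp only [WeierstrassCurve.b₂, WeierstrassCurve.b₄, WeierstrassCurve.b₆]
    field_simp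
    ring
  constructor
  · intro h
    rw [← key, h, zero_mul]
  · intro h
    rw [← key] at h
    exact (mul_eq_zero.mp h).resolve_right h4

omit [Field K] in
/-- `11664 · (4x³ + b₂x² + 2b₄x + b₆) = X³ - 27c₄X - 54c₆` with `X = 36x + 3b₂` (the change of
variables to the model `Y² = X³ - 27c₄X - 54c₆`), a polynomial identity in the `aᵢ` over any
commutative ring. [cite: SilvermanAEC2009, III.1 (c₄ = b₂² - 24b₄, c₆ = -b₂³ + 36b₂b₄ - 216b₆)] -/
theorem twoDivision_mul_eq_cubic {R : Type u} [CommRing R] (V : WeierstrassCurve R) (x : R) :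
    11664 * (4 * x ^ 3 + V.b₂ * x ^ 2 + 2 * V.b₄ * x + V.b₆) =
      (36 * x + 3 * V.b₂) ^ 3 - 27 * V.c₄ * (36 * x + 3 * V.b₂) - 54 * V.c₆ := by
  simp only [WeierstrassCurve.c₄, WeierstrassCurve.c₆]
  ring

/-- The ordinate `-(a₁x + a₃)/2` is its own `negY` (`2 ≠ 0`): the point `(x, -(a₁x + a₃)/2)`, when
on the curve, equals its negative. [cite: SilvermanAEC2009, Prop. III.2.3 (points of order 2)] -/
theorem negY_line_eq (h2 : (2 : K) ≠ 0) (x : K) :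
    -(W.a₁ * x + W.a₃) / 2 = W.toAffine.negY x (-(W.a₁ * x + W.a₃) / 2) := by
  rw [WeierstrassCurve.Affine.negY]
  field_simp
  ring

/-- **The `X₀(2)` relation makes `X = κ·c₆/c₄` a root of `X³ - 27c₄X - 54c₆`.**  If `W` is elliptic,
`1728 ≠ 0` in `K`, `κ ≠ 0` and `j·(κ³ - 27κ - 54) = 1728κ³`, then
`(κc₆/c₄)³ - 27c₄(κc₆/c₄) - 54c₆ = 0`.  (From `jΔ = c₄³` and `1728Δ = c₄³ - c₆²` the hypothesis
reads `c₄³(κ³ - 27κ - 54) = κ³(c₄³ - c₆²)`, i.e. `κ³c₆² = (27κ + 54)c₄³`, and `c₄ ≠ 0` as `j ≠ 0`.)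
[cite: SilvermanAEC2009, III.1 (1728Δ = c₄³ - c₆², j = c₄³/Δ)] -/
theorem cubic_root_of_j_mul_eq [W.IsElliptic] (h1728 : (1728 : K) ≠ 0) (κ : K) (hκ : κ ≠ 0)
    (hj : W.j * (κ ^ 3 - 27 * κ - 54) = 1728 * κ ^ 3) :
    (κ * W.c₆ / W.c₄) ^ 3 - 27 * W.c₄ * (κ * W.c₆ / W.c₄) - 54 * W.c₆ = 0 := by
  have hjΔ : W.j * W.Δ = W.c₄ ^ 3 := DokchitserDokchitser2012.j_mul_Δ W
  have hrel : 1728 * W.Δ = W.c₄ ^ 3 - W.c₆ ^ 2 := W.c_relation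
  have hj0 : W.j ≠ 0 := by
    intro h
    rw [h, zero_mul] at hj
    exact mul_ne_zero h1728 (pow_ne_zero 3 hκ) hj.symm
  have hc4 : W.c₄ ≠ 0 := fun h ↦ hj0 ((WeierstrassCurve.j_eq_zero_iff W).mpr h)
  have e1 : W.c₄ ^ 3 * (κ ^ 3 - 27 * κ - 54) = κ ^ 3 * (W.c₄ ^ 3 - W.c₆ ^ 2) := by
    linear_combination W.Δ * hj - (κ ^ 3 - 27 * κ - 54) * hjΔ + κ ^ 3 * hrel
  have hkey : κ ^ 3 * W.c₆ ^ 2 - (27 * κ + 54) * W.c₄ ^ 3 = 0 := by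
    linear_combination e1
  have hfac : (κ * W.c₆ / W.c₄) ^ 3 - 27 * W.c₄ * (κ * W.c₆ / W.c₄) - 54 * W.c₆ =
      (W.c₆ / W.c₄ ^ 3) * (κ ^ 3 * W.c₆ ^ 2 - (27 * κ + 54) * W.c₄ ^ 3) := by
    field_simp
    ring
  rw [hfac, hkey, mul_zero]

/-- **A rational point of exact order `2` from the `X₀(2)` parametrisation** (abscissa form).  Over a
field with `2 ≠ 0`, `3 ≠ 0`: if `W` is elliptic and `j·(κ³ - 27κ - 54) = 1728κ³` for some `κ ≠ 0`,
then with `x₀ := (κc₆/c₄ - 3b₂)/36` and `y₀ := -(a₁x₀ + a₃)/2` the point `(x₀, y₀)` lies on `W` and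
`2y₀ + a₁x₀ + a₃ = 0` (so it is a `K`-rational point of order `2`).  The relation
`j = 1728κ³/((κ + 3)²(κ - 6))` is, up to the change of parameter, the `j`-map of `X₀(2)`; e.g.
`κ = 5, -30/7, -30/11, -22/7, -170/57` give the CM values `j = -3375, 8000, 54000, 287496, 16581375`.
[cite: SilvermanAEC2009, Prop. III.2.3 (points of order 2) and III.1] -/
theorem exists_equation_two_torsion_of_j_mul_eq [W.IsElliptic] (h2 : (2 : K) ≠ 0) (h3 : (3 : K) ≠ 0)
    (κ : K) (hκ : κ ≠ 0) (hj : W.j * (κ ^ 3 - 27 * κ - 54) = 1728 * κ ^ 3) :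
    W.toAffine.Equation ((κ * W.c₆ / W.c₄ - 3 * W.b₂) / 36)
        (-(W.a₁ * ((κ * W.c₆ / W.c₄ - 3 * W.b₂) / 36) + W.a₃) / 2) ∧
      2 * (-(W.a₁ * ((κ * W.c₆ / W.c₄ - 3 * W.b₂) / 36) + W.a₃) / 2) +
        W.a₁ * ((κ * W.c₆ / W.c₄ - 3 * W.b₂) / 36) + W.a₃ = 0 := by
  set x₀ : K := (κ * W.c₆ / W.c₄ - 3 * W.b₂) / 36 with hx₀
  have h36 : (36 : K) ≠ 0 := by
    rw [show (36 : K) = 2 * 2 * 3 * 3 by norm_num]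
    exact mul_ne_zero (mul_ne_zero (mul_ne_zero h2 h2) h3) h3
  have h1728 : (1728 : K) ≠ 0 := by
    rw [show (1728 : K) = 2 ^ 6 * 3 ^ 3 by norm_num]
    exact mul_ne_zero (pow_ne_zero 6 h2) (pow_ne_zero 3 h3)
  have h11664 : (11664 : K) ≠ 0 := by
    rw [show (11664 : K) = 36 * 36 * 9 by norm_num]
    have h9 : (9 : K) ≠ 0 := by
      rw [show (9 : K) = 3 * 3 by norm_num]; exact mul_ne_zero h3 h3
    exact mul_ne_zero (mul_ne_zero h36 h36) h9
  have hX : 36 * x₀ + 3 * W.b₂ = κ * W.c₆ / W.c₄ := by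
    rw [hx₀]
    field_simp
    ring
  have hψ : 4 * x₀ ^ 3 + W.b₂ * x₀ ^ 2 + 2 * W.b₄ * x₀ + W.b₆ = 0 := by
    have h := twoDivision_mul_eq_cubic W x₀
    rw [hX, cubic_root_of_j_mul_eq W h1728 κ hκ hj] at h
    exact (mul_eq_zero.mp h).resolve_left h11664
  refine ⟨(equation_line_iff_twoDivision W h2 x₀).mpr hψ, ?_⟩
  field_simp
  ring

/-- **A rational point of exact order `2` from the `X₀(2)` parametrisation** (point form): over a
field with `2 ≠ 0`, `3 ≠ 0`, an elliptic `W` with `j·(κ³ - 27κ - 54) = 1728κ³` for some `κ ≠ 0` has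
a `K`-rational point `P ≠ 0` with `2P = 0`. [cite: SilvermanAEC2009, Prop. III.2.3 (points of order 2)] -/
theorem exists_two_torsion_of_j_mul_eq [DecidableEq K] [W.IsElliptic] (h2 : (2 : K) ≠ 0)
    (h3 : (3 : K) ≠ 0) (κ : K) (hκ : κ ≠ 0) (hj : W.j * (κ ^ 3 - 27 * κ - 54) = 1728 * κ ^ 3) :
    ∃ P : W.toAffine.Point, P ≠ 0 ∧ 2 • P = 0 := by
  obtain ⟨heq, -⟩ := exists_equation_two_torsion_of_j_mul_eq W h2 h3 κ hκ hj
  refine ⟨.some _ _ ((WeierstrassCurve.Affine.equation_iff_nonsingular).mp heq),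
    WeierstrassCurve.Affine.Point.some_ne_zero _, ?_⟩
  rw [two_nsmul, WeierstrassCurve.Affine.Point.add_self_of_Y_eq (negY_line_eq W h2 _)]

end XZeroTwo

/-! ### §2. A CM curve over `ℚ` is never onto modulo `4` -/

/-- The eight CM `j`-invariants on the curve `j = -4t³(t + 8)` and the five with a rational point of
order `2`, as one arithmetic lemma: every `j ∈ cmJInvariants` is `-4t³(t + 8)` for some `t ∈ ℚ`
(`t = -8, -6, 8, -24, 40, 120, -440, -16008`) or satisfies `j·(κ³ - 27κ - 54) = 1728κ³` for some
`κ ≠ 0` (`κ = 5, -30/7, -30/11, -22/7, -170/57`). [cite: SilvermanAEC2009, App. C §11 (the thirteen CM j-invariants)] [cite: DokchitserDokchitserMathZ2012, Lemma (3) (j = -4t³(t+8))] -/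
theorem exists_t_or_kappa_of_mem_cmJInvariants {j : ℚ} (hj : j ∈ WeierstrassCurve.cmJInvariants) :
    (∃ t : ℚ, j = -4 * t ^ 3 * (t + 8)) ∨
      ∃ κ : ℚ, κ ≠ 0 ∧ j * (κ ^ 3 - 27 * κ - 54) = 1728 * κ ^ 3 := by
  simp only [WeierstrassCurve.cmJInvariants, Finset.mem_insert, Finset.mem_singleton] at hj
  rcases hj with h | h | h | h | h | h | h | h | h | h | h | h | h <;> subst h
  · exact Or.inl ⟨-8, by norm_num⟩
  · exact Or.inl ⟨-6, by norm_num⟩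
  · exact Or.inr ⟨5, by norm_num, by norm_num⟩
  · exact Or.inr ⟨-30 / 7, by norm_num, by norm_num⟩
  · exact Or.inl ⟨8, by norm_num⟩
  · exact Or.inr ⟨-30 / 11, by norm_num, by norm_num⟩
  · exact Or.inr ⟨-22 / 7, by norm_num, by norm_num⟩
  · exact Or.inl ⟨-24, by norm_num⟩
  · exact Or.inl ⟨40, by norm_num⟩
  · exact Or.inr ⟨-170 / 57, by norm_num, by norm_num⟩
  · exact Or.inl ⟨120, by norm_num⟩
  · exact Or.inl ⟨-440, by norm_num⟩
  · exact Or.inl ⟨-16008, by norm_num⟩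

/-- **For an elliptic curve `E/ℚ` with (geometric) complex multiplication, `ρ̄_{E,4} : Γ_ℚ → Aut(E[4])`
is NOT onto** — any model `W`.  Proof: `j(W) ∈ cmJInvariants` (`hasCM_iff_j_mem_holds`); by
`exists_t_or_kappa_of_mem_cmJInvariants` either `j = -4t³(t + 8)`, excluded by Dokchitser–Dokchitser
(2) (`hasSurjectiveModNGaloisRep_four_iff`), or `W(ℚ)` has a point of order `2`
(`exists_two_torsion_of_j_mul_eq`), excluded by Dokchitser–Dokchitser (1) since `ρ̄₄` onto forces
`ρ̄₂` onto.  In print: Lozano-Robledo 2022, Thm. 1.1 at `N = 4` (image inside a Cartan normaliser).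
[cite: LozanoRobledo2022, Thm. 1.1 (N = 4)] [cite: DokchitserDokchitserMathZ2012, Theorem (1), (2)] -/
theorem _root_.WeierstrassCurve.not_hasSurjectiveModNGaloisRep_four_of_hasCM (W : WeierstrassCurve ℚ)
    [W.IsElliptic] (hCM : W.HasCM) : ¬ W.HasSurjectiveModNGaloisRep 4 := by
  intro h4
  obtain ⟨h2, -, hjt⟩ := (DokchitserDokchitser2012.hasSurjectiveModNGaloisRep_four_iff W).mp h4
  have hno2 : ∀ P : W.toAffine.Point, 2 • P = 0 → P = 0 :=
    ((hasSurjectiveModNGaloisRep_two_iff W).mp h2).1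
  rcases exists_t_or_kappa_of_mem_cmJInvariants ((WeierstrassCurve.hasCM_iff_j_mem_holds W).mp hCM)
    with ⟨t, ht⟩ | ⟨κ, hκ, hj⟩
  · exact hjt t ht
  · obtain ⟨P, hP0, h2P⟩ := exists_two_torsion_of_j_mul_eq W two_ne_zero three_ne_zero κ hκ hj
    exact hP0 (hno2 P h2P)

/-- **`ρ̄_{E,4}` onto ⟹ no CM** (contrapositive of
`WeierstrassCurve.not_hasSurjectiveModNGaloisRep_four_of_hasCM`). [cite: LozanoRobledo2022, Thm. 1.1 (N = 4)] -/
theorem _root_.WeierstrassCurve.not_hasCM_of_hasSurjectiveModNGaloisRep_four (W : WeierstrassCurve ℚ)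
    [W.IsElliptic] (h4 : W.HasSurjectiveModNGaloisRep 4) : ¬ W.HasCM :=
  fun hCM ↦ W.not_hasSurjectiveModNGaloisRep_four_of_hasCM hCM h4

/-- **For a CM curve `E/ℚ`, `ρ̄_{E,2^m}` is not onto for any `m ≥ 2`** (`ρ̄_{2^m}` onto would make
`ρ̄₄` onto: `hasSurjectiveModNGaloisRep_pow_of_pow_add`).  At `m = 1` this fails (e.g. `y² = x³ + 2`
has `Gal(ℚ(E[2])/ℚ) ≅ S₃`). [cite: LozanoRobledo2022, Thm. 1.1 (N = 2^m, m ≥ 2)] -/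
theorem _root_.WeierstrassCurve.not_hasSurjectiveModNGaloisRep_two_pow_of_hasCM
    (W : WeierstrassCurve ℚ) [W.IsElliptic] (hCM : W.HasCM) {m : ℕ} (hm : 2 ≤ m) :
    ¬ W.HasSurjectiveModNGaloisRep ((2 ^ m : ℕ) : ℤ) := by
  intro h
  haveI : Fact (Nat.Prime 2) := ⟨Nat.prime_two⟩
  obtain ⟨j, rfl⟩ := Nat.exists_eq_add_of_le hm
  have h4 := hasSurjectiveModNGaloisRep_pow_of_pow_add W 2 2 j two_pos (by norm_num) h
  exact W.not_hasSurjectiveModNGaloisRep_four_of_hasCM hCM (by simpa using h4)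

/-- **A CM curve over `ℚ` is OFF the surjective-`2`-adic-image habitat**: `¬ ∀ m, ρ̄_{E,2^m}` onto
(habitat binder spelling of the BSD routes `TwoAdicConverse` / `KolyvaginRankRigidityAtTwo`).
[cite: LozanoRobledo2022, Thm. 1.1 (N = 4)] -/
theorem _root_.WeierstrassCurve.not_forall_hasSurjectiveModNGaloisRep_two_pow_of_hasCM
    (W : WeierstrassCurve ℚ) [W.IsElliptic] (hCM : W.HasCM) :
    ¬ ∀ m : ℕ, W.HasSurjectiveModNGaloisRep ((2 ^ m : ℕ) : ℤ) :=
  fun h ↦ W.not_hasSurjectiveModNGaloisRep_two_pow_of_hasCM hCM le_rfl (h 2)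

/-- **A surjective `2`-adic image excludes CM**: if `ρ̄_{E,2^m}` is onto for every `m` then `E` has
no complex multiplication — so the binder `¬ W.HasCM` carried next to `∀ m, ρ̄_{E,2^m}` onto by the
BSD routes at `p = 2` is implied by the habitat binder. [cite: LozanoRobledo2022, Thm. 1.1 (N = 4)] -/
theorem _root_.WeierstrassCurve.not_hasCM_of_forall_hasSurjectiveModNGaloisRep_two_pow
    (W : WeierstrassCurve ℚ) [W.IsElliptic] (h : ∀ m : ℕ, W.HasSurjectiveModNGaloisRep ((2 ^ m : ℕ) : ℤ)) :
    ¬ W.HasCM :=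
  fun hCM ↦ W.not_forall_hasSurjectiveModNGaloisRep_two_pow_of_hasCM hCM h

/-! ### §3. The complement of the surjective-`2`-adic-image habitat, typed exactly -/

/-- **The `2`-adic image is decided modulo `8`:** `ρ̄_{E,2^m}` is onto for every `m` iff `ρ̄_{E,8}` is
onto (⟸ is the tree's discharge `hasSurjectiveModNGaloisRep_two_pow_of_eight_holds`; ⟹ is `m = 3`).
[cite: RouseZureickbrown2015, §3 Lemma and §1] [cite: DokchitserDokchitserMathZ2012, Introduction (p. 961)] -/
theorem forall_hasSurjectiveModNGaloisRep_two_pow_iff_eight (W : WeierstrassCurve ℚ) [W.IsElliptic] :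
    (∀ m : ℕ, W.HasSurjectiveModNGaloisRep ((2 ^ m : ℕ) : ℤ)) ↔ W.HasSurjectiveModNGaloisRep 8 := by
  constructor
  · intro h
    simpa using h 3
  · intro h8 m
    have h := hasSurjectiveModNGaloisRep_two_pow_of_eight_holds W h8 m
    simpa using h

/-- **Criteria for a surjective `2`-adic image, as an equivalence** (Dokchitser–Dokchitser (1)–(3)
assembled with the mod-`8` lift): `ρ̄_{E,2^m}` onto for all `m` iff `E(ℚ)` has no point of order `2`,
`Δ, -Δ ∉ ℚ^{×2}`, `j ≠ -4t³(t + 8)` for all `t`, and `2Δ, -2Δ ∉ ℚ^{×2}`.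
[cite: DokchitserDokchitserMathZ2012, Theorem (1)–(3)] [cite: RouseZureickbrown2015, §3 Lemma and §1] -/
theorem forall_hasSurjectiveModNGaloisRep_two_pow_iff_criteria (W : WeierstrassCurve ℚ) [W.IsElliptic] :
    (∀ m : ℕ, W.HasSurjectiveModNGaloisRep ((2 ^ m : ℕ) : ℤ)) ↔
      (∀ P : W.toAffine.Point, 2 • P = 0 → P = 0) ∧ ¬ IsSquare W.Δ ∧ ¬ IsSquare (-W.Δ) ∧
        (∀ t : ℚ, W.j ≠ -4 * t ^ 3 * (t + 8)) ∧ ¬ IsSquare (2 * W.Δ) ∧ ¬ IsSquare (-2 * W.Δ) := by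
  rw [forall_hasSurjectiveModNGaloisRep_two_pow_iff_eight,
    DokchitserDokchitser2012.hasSurjectiveModNGaloisRep_eight_iff,
    DokchitserDokchitser2012.hasSurjectiveModNGaloisRep_four_iff, hasSurjectiveModNGaloisRep_two_iff]
  tauto

/-- **The complement of the surjective-`2`-adic-image habitat is the union of five families**: for an
elliptic curve `E/ℚ` (any model), `¬ ∀ m, ρ̄_{E,2^m}` onto iff (β) `E(ℚ)` has a point of order `2`
(`E[2]` reducible), or (γ₁) `Δ ∈ ℚ^{×2}` (`C₃` image modulo `2`), or (γ₂) `-Δ ∈ ℚ^{×2}`, or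
(γ₃) `j(E) = -4t³(t + 8)` for some `t ∈ ℚ`, or (γ₄) `2Δ ∈ ℚ^{×2}` or `-2Δ ∈ ℚ^{×2}`.
[cite: DokchitserDokchitserMathZ2012, Theorem (1)–(3)] [cite: RouseZureickbrown2015, §3 Lemma and §1] -/
theorem not_forall_hasSurjectiveModNGaloisRep_two_pow_iff (W : WeierstrassCurve ℚ) [W.IsElliptic] :
    (¬ ∀ m : ℕ, W.HasSurjectiveModNGaloisRep ((2 ^ m : ℕ) : ℤ)) ↔
      (∃ P : W.toAffine.Point, P ≠ 0 ∧ 2 • P = 0) ∨ IsSquare W.Δ ∨ IsSquare (-W.Δ) ∨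
        (∃ t : ℚ, W.j = -4 * t ^ 3 * (t + 8)) ∨ IsSquare (2 * W.Δ) ∨ IsSquare (-2 * W.Δ) := by
  rw [forall_hasSurjectiveModNGaloisRep_two_pow_iff_criteria]
  constructor
  · intro h
    by_contra hc
    simp only [not_or, not_exists, not_and] at hc
    obtain ⟨hP, hΔ, hΔ₁, ht, hΔ₂, hΔ₃⟩ := hc
    exact h ⟨fun P h2P ↦ by_contra fun hP0 ↦ hP P hP0 h2P, hΔ, hΔ₁, fun t hjt ↦ ht t hjt, hΔ₂, hΔ₃⟩
  · rintro (⟨P, hP0, h2P⟩ | hΔ | hΔ₁ | ⟨t, ht⟩ | hΔ₂ | hΔ₃) ⟨hP, hΔ', hΔ₁', ht', hΔ₂', hΔ₃'⟩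
    · exact hP0 (hP P h2P)
    · exact hΔ' hΔ
    · exact hΔ₁' hΔ₁
    · exact ht' t ht
    · exact hΔ₂' hΔ₂
    · exact hΔ₃' hΔ₃

/-- **Off the habitat, case split** (the form consumed by glue theorems): if `ρ_{E,2^∞}` is not onto
then one of the five families (β), (γ₁), (γ₂), (γ₃), (γ₄) holds.
[cite: DokchitserDokchitserMathZ2012, Theorem (1)–(3)] -/
theorem offHabitat_cases (W : WeierstrassCurve ℚ) [W.IsElliptic]
    (h : ¬ ∀ m : ℕ, W.HasSurjectiveModNGaloisRep ((2 ^ m : ℕ) : ℤ)) :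
    (∃ P : W.toAffine.Point, P ≠ 0 ∧ 2 • P = 0) ∨ IsSquare W.Δ ∨ IsSquare (-W.Δ) ∨
      (∃ t : ℚ, W.j = -4 * t ^ 3 * (t + 8)) ∨ IsSquare (2 * W.Δ) ∨ IsSquare (-2 * W.Δ) :=
  (not_forall_hasSurjectiveModNGaloisRep_two_pow_iff W).mp h

/-- **A CM curve lies in family (β) or (γ₃)**: its `j` is `-4t³(t + 8)` or it has a rational point of
order `2` (the two CM branches of §2, recorded for the typed split of the off-habitat complement).
[cite: LozanoRobledo2022, Thm. 1.1 (N = 4)] [cite: SilvermanAEC2009, App. C §11] -/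
theorem exists_two_torsion_or_j_eq_of_hasCM (W : WeierstrassCurve ℚ) [W.IsElliptic] (hCM : W.HasCM) :
    (∃ P : W.toAffine.Point, P ≠ 0 ∧ 2 • P = 0) ∨ ∃ t : ℚ, W.j = -4 * t ^ 3 * (t + 8) := by
  rcases exists_t_or_kappa_of_mem_cmJInvariants ((WeierstrassCurve.hasCM_iff_j_mem_holds W).mp hCM)
    with ⟨t, ht⟩ | ⟨κ, hκ, hj⟩
  · exact Or.inr ⟨t, ht⟩
  · exact Or.inl (exists_two_torsion_of_j_mul_eq W two_ne_zero three_ne_zero κ hκ hj)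

end Literature.NumberTheory.EllipticCurves
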